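import Summits.HodgeConjecture.HodgeConjecture.Theorems.VHCAbelianSchemesRoadNowhereDisplaceableDefs
import Literature.AlgebraicGeometry.Motives.AbelianVarietyBlochFiltrationTransfer
import HarnessLib

/-!
# Road №4 (`VHCAbelianSchemesRoad`), crux stmt-HodgeConjecture-26512 `DiagLocalOfMarkmanPinnedForall` — support to lens line N′:
# (U-pre) THE PREIMAGE OF A PROPER CLOSED SUBSCHEME UNDER AN ISOGENY LIES IN A PROPER CLOSED SUBSCHEME

research route conditional on HC_CM; not a corollary; Q11.4-sentence-2 already refuted in dim ≥ 3.

FILE 5 of the req-51 plate (director-hodge g17 R17.35 (5), idea-crit-6 g4 RULING 26512-T2, plan-lens-HodgeAV-26512-transfer g3): the card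
«factor-jump-isogeny»'s FIRST LEMMA (U-pre) `stub_preimage_properClosed_of_isIsogeny`, statement VERBATIM from
`Cruxes/DiagLocalOfMarkmanPinnedForall/FactorJumpIsogeny.lean` d388a423a887a709 l.34 (the upstairs sibling of (N-I) `properJump_of_confinedLifts`,
p673373): for an isogeny `Λ : J × Ĵ → J × Ĵ` and a closed `κ : W ↪ J × Ĵ` with `W(ℂ) ≠ (J × Ĵ)(ℂ)` there is a closed `ι : V ↪ J × Ĵ` with
`V(ℂ) ≠ (J × Ĵ)(ℂ)` receiving every `ℂ`-point `p` with `Λ(p) ∈ W(ℂ)`.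

PROOF (scheme API only). `V := W ×_{J × Ĵ, Λ} (J × Ĵ)` (Mathlib `Limits.pullback κ Λ`), `ι := pullback.snd` — a closed immersion by base change;
a `ℂ`-point `p` with `Λ(p) = κ(w)` lifts to `V` by `pullback.lift w p`; and `V(ℂ) = (J × Ĵ)(ℂ)` would give `Λ(p) = κ(fst(v_p)) ∈ W(ℂ)` for EVERY
`p` (`pullback.condition`), so `W(ℂ) ⊇ Λ((J × Ĵ)(ℂ)) = (J × Ĵ)(ℂ)` because an isogeny is onto on `ℂ`-points (`AbelianVariety.pointsMap_surjective`) —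
contradiction.

Everything is proved; no `sorry`, no named fact, standard axioms. NOTHING here says (U-fac), (N-U), (N-F), (S4), the crux, №4, HC_AV, HC_CM or HC
holds; HC_CM HELD, by name only; typed ≠ proved. [cite: MumfordAV1970, §7 Thm. 4 (p. 72)] [cite: GortzWedhorn2020, Prop. 4.20 and §4.11]
-/

noncomputable section

open CategoryTheory CategoryTheory.Limits AlgebraicGeometry Topology

namespace Summit.HodgeConjecture.HodgeConjecture.Ring2.SemiregularRepresentatives

set_option linter.dupNamespace false -- the cell's namespace repeats the summit name, as in every `Ring2*` file

namespace NowhereDisplaceable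

open Literature.AlgebraicGeometry Literature.AlgebraicGeometry.Motives Literature.AlgebraicGeometry.Motives.AbelianVariety
open Summit.HodgeConjecture.HodgeConjecture.Ring2.SemiregularRepresentatives.MoverTrap

/-- **(U-pre) — THE PREIMAGE UNDER AN ISOGENY OF A PROPER CLOSED SUBSCHEME LIES IN A PROPER CLOSED SUBSCHEME** (VERBATIM the card's stub
`stub_preimage_properClosed_of_isIsogeny`, `Cruxes/…/FactorJumpIsogeny.lean` d388a423a887a709 l.34): take `V := Λ⁻¹(W) = W ×_{J × Ĵ} (J × Ĵ)` (base
change of the closed immersion `κ` along `Λ`); `ℂ`-points over `W` lift by the universal property, and `V(ℂ) ≠ (J × Ĵ)(ℂ)` because `Λ` is onto on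
`ℂ`-points while `W(ℂ) ≠ (J × Ĵ)(ℂ)`. [cite: MumfordAV1970, §7 Thm. 4 (p. 72)] [cite: GortzWedhorn2020, Prop. 4.20 and §4.11 (base change of immersions)] -/
theorem preimage_properClosed_of_isIsogeny :
    ∀ (D : SecantQuotientDatum) (Λ : D.P ⟶ D.P), IsIsogeny Λ →
      ∀ (W : SchemeOver ℂ) (κ : W ⟶ D.P.X), IsClosedImmersion κ.left →
        Set.range (AlgPoints.map (L := ℂ) κ) ≠ Set.univ →
        ∃ (V : SchemeOver ℂ) (ι : V ⟶ D.P.X), IsClosedImmersion ι.left ∧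
          Set.range (AlgPoints.map (L := ℂ) ι) ≠ Set.univ ∧
          ∀ p : D.P.Points ℂ, AlgPoints.map Λ.hom.hom.hom p ∈ Set.range (AlgPoints.map (L := ℂ) κ) →
            p ∈ Set.range (AlgPoints.map (L := ℂ) ι) := by
  intro D Λ hΛ W κ hκ hW
  haveI := hκ
  -- `V := W ×_{P, Λ} P`, `ι := pr₂`
  have hΛP : Hom.toSchemeHom Λ ≫ D.P.X.hom = D.P.X.hom := Over.w Λ.hom.hom.hom
  let V : SchemeOver ℂ := Over.mk (pullback.snd κ.left (Hom.toSchemeHom Λ) ≫ D.P.X.hom)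
  let ι : V ⟶ D.P.X := Over.homMk (pullback.snd κ.left (Hom.toSchemeHom Λ)) rfl
  refine ⟨V, ι, ?_, ?_, ?_⟩
  · -- base change of a closed immersion
    change IsClosedImmersion (pullback.snd κ.left (Hom.toSchemeHom Λ))
    infer_instance
  · -- `V(ℂ) ≠ P(ℂ)`: otherwise `Λ(P(ℂ)) ⊆ W(ℂ)` and `Λ` is onto on `ℂ`-points
    intro hV
    apply hW
    refine Set.eq_univ_of_forall fun x => ?_
    obtain ⟨p, rfl⟩ := pointsMap_surjective Λ hΛ.1 x
    obtain ⟨v, hv⟩ := (Set.range_eq_univ.1 hV) p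
    -- the underlying map of `v`, typed into the fibre product
    let vl : (specOver ℂ ℂ).left ⟶ pullback κ.left (Hom.toSchemeHom Λ) := v.left
    have hv' : vl ≫ pullback.snd κ.left (Hom.toSchemeHom Λ) = p.left := congrArg (fun f => f.left) hv
    refine ⟨Over.homMk (vl ≫ pullback.fst κ.left (Hom.toSchemeHom Λ)) ?_, ?_⟩
    · rw [Category.assoc, ← Over.w κ, pullback.condition_assoc, hΛP, ← Category.assoc, hv']
      exact Over.w p
    · ext1
      change (vl ≫ pullback.fst κ.left (Hom.toSchemeHom Λ)) ≫ κ.left = p.left ≫ Hom.toSchemeHom Λ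
      rw [Category.assoc, pullback.condition, ← Category.assoc, hv']
  · -- `ℂ`-points over `W` lift to `V`
    rintro p ⟨w, hw⟩
    have hcomm : w.left ≫ κ.left = p.left ≫ Hom.toSchemeHom Λ := by
      have := congrArg (fun f => f.left) hw
      simpa only [Over.comp_left, AlgPoints.map_apply] using this
    refine ⟨Over.homMk (pullback.lift w.left p.left hcomm) ?_, ?_⟩
    · change pullback.lift w.left p.left hcomm ≫ pullback.snd κ.left (Hom.toSchemeHom Λ) ≫ D.P.X.hom = (specOver ℂ ℂ).hom
      rw [pullback.lift_snd_assoc, Over.w p]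
    · ext1
      change pullback.lift w.left p.left hcomm ≫ pullback.snd κ.left (Hom.toSchemeHom Λ) = p.left
      rw [pullback.lift_snd]

end NowhereDisplaceable

end Summit.HodgeConjecture.HodgeConjecture.Ring2.SemiregularRepresentatives
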